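import Literature.NumberTheory.EllipticCurves.WeierstrassTransformationFive
import Literature.NumberTheory.EllipticCurves.WeierstrassLaurent
import Literature.NumberTheory.EllipticCurves.RealLatticePeriodProofs
import HarnessLib

/-!
# Transformations of `℘` of odd order and the Laurent-matching equations for complex multiplication

Topic `NumberTheory/EllipticCurves`; dot-notation extensions of Mathlib's `PeriodPair`, continuing
`WeierstrassTransformation.lean` / `WeierstrassTransformationFive.lean` (orders `2, 3, 5`) and
`WeierstrassLaurent.lean` (Taylor coefficients of `℘ − z⁻²` at `0`).  Everything here is
**proved**; it is the reusable infrastructure of the method of Stark (Cox, *Primes of the form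
x² + ny²*, §10.C, (10.21)–(10.22): compare the Laurent expansions of `℘(αz)` and `℘(z)` for a
complex multiplication `α`) in **arbitrary odd norm `2d + 1`**, as needed for the rows
`d_K = −43, −67, −163` of the class-number-one table of singular moduli (Cox §12.C (12.20);
`Literature.NumberTheory.EllipticCurves.singularModuli_classNumberOne`), where `α = (1 + √d_K)/2` has norm `11, 17, 41`.

* `PeriodPair.iteratedDeriv_weierstrassPExcept_sub_of_transformation` : if
  `℘_{Λ'}(z) = Σ_{c ∈ S} ℘_Λ(z − c) − K` off `Λ'` (the transformation of order `n`,
  `PeriodPair.weierstrassP_transformation`), then for `n ≥ 1` the `n`-th Taylor coefficients at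
  `0` satisfy `(℘⁻_{Λ'})⁽ⁿ⁾(0) − (℘⁻_Λ)⁽ⁿ⁾(0) = Σ_{c ∈ S, c ≠ 0} ℘_Λ⁽ⁿ⁾(−c)` (`℘⁻ = ℘ − z⁻²`;
  identity theorem for the analytic germ at `0`).
* `PeriodPair.repsOdd w d = {kw : |k| ≤ d}` and its bookkeeping (`repsOdd_incongruent`,
  `sum_repsOdd_erase_zero` : `Σ_{0<|k|≤d} f(℘(kw)) = 2Σ_{k=1}^{d} f(℘(kw))`).
* `PeriodPair.cmOdd_transformation` : if `α⁻¹Λ = ⋃_{|k| ≤ d} (kw + Λ)` and `kw ∉ Λ` for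
  `0 < |k| ≤ 2d`, the transformation formula
  `℘_{α⁻¹Λ}(z) = Σ_{|k| ≤ d} ℘_Λ(z − kw) − Σ_{0 < |k| ≤ d} ℘_Λ(kw)`.
* `PeriodPair.cmOdd_taylor`, `PeriodPair.cmOdd_taylor_even` : **the Laurent-matching equations**
  `(n+1)!·(αⁿ⁺² − 1)·G_{n+2}(Λ) = Σ_{0<|k|≤d} ℘⁽ⁿ⁾(−kw)` (`G_{n+2}(α⁻¹Λ) = αⁿ⁺²G_{n+2}(Λ)`), and,
  when `℘⁽ⁿ⁾ = P(℘)` off `Λ`, `= 2Σ_{k=1}^{d} P(℘(kw))`.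
* `PeriodPair.iteratedDeriv_2_weierstrassP_eq`, …, `PeriodPair.iteratedDeriv_16_weierstrassP_eq` :
  **the even derivatives of `℘` as polynomials in `℘`**, `℘⁽²ᵐ⁾ = P_m(℘)` for `m ≤ 8`
  (`P₁ = 6X² − g₂/2`, `P_{m+1} = P_m″·(4X³ − g₂X − g₃) + P_m′·(6X² − g₂/2)`, from `℘'² = 4℘³ − g₂℘ − g₃`
  and `℘″ = 6℘² − g₂/2`), with the odd derivatives `℘⁽²ᵐ⁺¹⁾ = P_m′(℘)℘′` in between; the
  coefficient tables `PeriodPair.pc1, …, PeriodPair.pc8` were generated by this recursion (PARI/GP)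
  and are *verified* here step by step (`ring`).

Why here: with these, the singular modulus of an order with a CM element of odd prime norm
`ℓ = 2d + 1` reduces to polynomial algebra in the power sums of `℘(w), …, ℘(dw)` and `G₄, G₆`
(`WeierstrassCMEleven.lean` for `ℓ = 11`, `d_K = −43`).

## References

* D. A. Cox, *Primes of the form x² + ny²*, 2nd ed., Wiley 2013: §10.C eqs. (10.21)–(10.22)
  (PDF pp. 223–224).
* D. F. Lawden, *Elliptic Functions and Applications*, Springer 1989, §9.8 (transformations of
  order `n`), §6.6–6.7 (`℘'² = 4℘³ − g₂℘ − g₃`, `℘″ = 6℘² − g₂/2`).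
-/

noncomputable section

open scoped Topology
open Filter Set Complex

namespace PeriodPair


section TaylorTransformation

variable {L L' : PeriodPair} {S : Finset ℂ} {K : ℂ}

/-! ### The Taylor coefficients of `℘_{Λ'} − ℘_Λ` at the origin under a transformation -/

attribute [local fun_prop] AnalyticAt.contDiffAt in
/-- **Taylor coefficients under a transformation.**  Suppose `℘_{Λ'}(z) = Σ_{c ∈ S} ℘_Λ(z − c) − K`
off `Λ'` (the transformation of order `n`, `PeriodPair.weierstrassP_transformation`), with `0 ∈ S`
and the nonzero representatives off `Λ`.  Then for every `n ≥ 1` the Taylor coefficients at `0`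
of `℘⁻_{Λ'} − ℘⁻_Λ` (`℘⁻ = ℘ − z⁻²`) are `Σ_{c ∈ S, c ≠ 0} ℘_Λ⁽ⁿ⁾(−c)`:
`(℘⁻_{Λ'})⁽ⁿ⁾(0) − (℘⁻_Λ)⁽ⁿ⁾(0) = Σ_{c ≠ 0} ℘_Λ⁽ⁿ⁾(−c)`. [folklore] -/
theorem iteratedDeriv_weierstrassPExcept_sub_of_transformation (hS0 : (0 : ℂ) ∈ S)
    (hS : ∀ c ∈ S.erase 0, c ∉ L.lattice)
    (hT : ∀ z, z ∉ L'.lattice → ℘[L'] z = ∑ c ∈ S, ℘[L] (z - c) - K) {n : ℕ} (hn : n ≠ 0) :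
    iteratedDeriv n ℘[L' - (0 : ℂ)] 0 - iteratedDeriv n ℘[L - (0 : ℂ)] 0 =
      ∑ c ∈ S.erase 0, iteratedDeriv n ℘[L] (-c) := by
  -- the germ `g = ℘⁻' − ℘⁻ − Σ_{c≠0} ℘(· − c) + K` vanishes near `0`
  have hS' : ∀ c ∈ S.erase 0, (0 : ℂ) - c ∉ L.lattice := fun c hc h ↦
    hS c hc (by simpa using neg_mem h)
  have hsum : AnalyticAt ℂ (fun z ↦ ∑ c ∈ S.erase 0, ℘[L] (z - c)) 0 :=
    Finset.analyticAt_fun_sum _ fun c hc ↦ L.analyticAt_weierstrassP_sub_const c (hS' c hc)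
  have hg : AnalyticAt ℂ (fun z ↦ ℘[L' - (0 : ℂ)] z - ℘[L - (0 : ℂ)] z -
      ∑ c ∈ S.erase 0, ℘[L] (z - c) + K) 0 := by
    have h1 := L'.analyticAt_weierstrassPExcept (0 : ℂ)
    have h2 := L.analyticAt_weierstrassPExcept (0 : ℂ)
    exact ((h1.sub h2).sub hsum).add analyticAt_const
  have hpunct : ∀ᶠ z in 𝓝[≠] (0 : ℂ), ℘[L' - (0 : ℂ)] z - ℘[L - (0 : ℂ)] z -
      ∑ c ∈ S.erase 0, ℘[L] (z - c) + K = 0 := by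
    filter_upwards [self_mem_nhdsWithin,
      mem_nhdsWithin_of_mem_nhds (L'.compl_lattice_sdiff_singleton_mem_nhds 0)] with z hz0 hz
    have hzΛ' : z ∉ L'.lattice := fun h ↦ hz ⟨h, hz0⟩
    have h := hT z hzΛ'
    rw [← Finset.add_sum_erase S (fun c ↦ ℘[L] (z - c)) hS0, sub_zero,
      L'.weierstrassP_eq_weierstrassPExcept_add z, L.weierstrassP_eq_weierstrassPExcept_add z] at h
    linear_combination h
  have hzero : (fun z ↦ ℘[L' - (0 : ℂ)] z - ℘[L - (0 : ℂ)] z -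
      ∑ c ∈ S.erase 0, ℘[L] (z - c) + K) =ᶠ[𝓝 0] fun _ ↦ (0 : ℂ) := by
    rcases hg.eventually_eq_zero_or_eventually_ne_zero with h | h
    · exact h
    · exact absurd (h.and hpunct).exists (by simp)
  have hD := hzero.iteratedDeriv_eq n
  rw [iteratedDeriv_const] at hD
  simp only [hn, ↓reduceIte] at hD
  have hc : ∀ m, ContDiffAt ℂ m (fun z ↦ ∑ c ∈ S.erase 0, ℘[L] (z - c)) 0 := fun m ↦
    hsum.contDiffAt
  have hc' : ∀ c ∈ S.erase 0, ContDiffAt ℂ n (fun z ↦ ℘[L] (z - c)) 0 := fun c hc ↦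
    (L.analyticAt_weierstrassP_sub_const c (hS' c hc)).contDiffAt
  rw [iteratedDeriv_fun_add (by fun_prop) (by fun_prop),
    iteratedDeriv_fun_sub (by fun_prop) (hc n),
    iteratedDeriv_fun_sub (by fun_prop) (by fun_prop), iteratedDeriv_const,
    iteratedDeriv_fun_sum hc'] at hD
  simp only [hn, ↓reduceIte, add_zero] at hD
  have ht : ∀ c ∈ S.erase 0, iteratedDeriv n (fun z ↦ ℘[L] (z - c)) 0 =
      iteratedDeriv n ℘[L] (-c) := fun c _ ↦ by
    rw [iteratedDeriv_comp_sub_const]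
    simp
  rw [Finset.sum_congr rfl ht] at hD
  linear_combination hD



end TaylorTransformation

section RepsOdd

variable {L : PeriodPair} {w : ℂ} {d : ℕ}

/-! ### Representatives `{kw : |k| ≤ d}` of a cyclic superlattice of odd index `2d + 1` -/

/-- The representatives `{kw : −d ≤ k ≤ d}`. [folklore] -/
def repsOdd (w : ℂ) (d : ℕ) : Finset ℂ := (Finset.Icc (-(d : ℤ)) d).image fun k : ℤ ↦ (k : ℂ) * w

/-- `0 ∈ repsOdd w d`. [folklore] -/
lemma zero_mem_repsOdd (w : ℂ) (d : ℕ) : (0 : ℂ) ∈ repsOdd w d :=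
  Finset.mem_image.mpr ⟨0, by simp, by simp⟩

/-- Membership in the coset union, representative form. [folklore] -/
lemma exists_mem_repsOdd_iff (x : ℂ) :
    (∃ c ∈ repsOdd w d, x - c ∈ L.lattice) ↔
      ∃ k : ℤ, -(d : ℤ) ≤ k ∧ k ≤ d ∧ x - k * w ∈ L.lattice := by
  simp only [repsOdd, Finset.mem_image, Finset.mem_Icc]
  constructor
  · rintro ⟨c, ⟨k, ⟨hk1, hk2⟩, rfl⟩, hx⟩
    exact ⟨k, hk1, hk2, hx⟩
  · rintro ⟨k, hk1, hk2, hx⟩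
    exact ⟨_, ⟨k, ⟨hk1, hk2⟩, rfl⟩, hx⟩

/-- `w ≠ 0` when `w ∉ Λ`-type hypotheses hold. [folklore] -/
lemma w_ne_zero_of_smul_notMem
    (hsmall : ∀ k : ℤ, k ≠ 0 → -(2 * d : ℤ) ≤ k → k ≤ 2 * d → (k : ℂ) * w ∉ L.lattice)
    (hd : 1 ≤ d) : w ≠ 0 := by
  intro hw
  exact hsmall 1 one_ne_zero (by omega) (by omega) (by simp [hw])

/-- The representatives are pairwise incongruent mod `Λ` when `kw ∉ Λ` for `0 < |k| ≤ 2d`.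
[folklore] -/
lemma repsOdd_incongruent
    (hsmall : ∀ k : ℤ, k ≠ 0 → -(2 * d : ℤ) ≤ k → k ≤ 2 * d → (k : ℂ) * w ∉ L.lattice) :
    ∀ c ∈ repsOdd w d, ∀ c' ∈ repsOdd w d, c - c' ∈ L.lattice → c = c' := by
  intro c hc c' hc' h
  simp only [repsOdd, Finset.mem_image, Finset.mem_Icc] at hc hc'
  obtain ⟨k, ⟨hk1, hk2⟩, rfl⟩ := hc
  obtain ⟨k', ⟨hl1, hl2⟩, rfl⟩ := hc'
  have hm : ((k - k' : ℤ) : ℂ) * w ∈ L.lattice := by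
    push_cast
    rw [sub_mul]
    exact h
  by_contra hne
  have hkk : k - k' ≠ 0 := fun h0 ↦ hne (by rw [show k = k' by omega])
  exact hsmall (k - k') hkk (by omega) (by omega) hm

/-- Nonzero representatives are off `Λ`. [folklore] -/
lemma notMem_of_mem_repsOdd_erase
    (hsmall : ∀ k : ℤ, k ≠ 0 → -(2 * d : ℤ) ≤ k → k ≤ 2 * d → (k : ℂ) * w ∉ L.lattice)
    {c : ℂ} (hc : c ∈ (repsOdd w d).erase 0) : c ∉ L.lattice := by
  obtain ⟨hc0, hc⟩ := Finset.mem_erase.mp hc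
  simp only [repsOdd, Finset.mem_image, Finset.mem_Icc] at hc
  obtain ⟨k, ⟨hk1, hk2⟩, rfl⟩ := hc
  have hk : k ≠ 0 := fun h ↦ hc0 (by simp [h])
  exact hsmall k hk (by omega) (by omega)

/-- `Σ_{k=-d}^{d} h(k) = h(0) + Σ_{i<d} (h(i+1) + h(−(i+1)))`. [folklore] -/
lemma sum_Icc_neg_self (h : ℤ → ℂ) (d : ℕ) :
    ∑ k ∈ Finset.Icc (-(d : ℤ)) d, h k =
      h 0 + ∑ i ∈ Finset.range d, (h ((i : ℤ) + 1) + h (-((i : ℤ) + 1))) := by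
  induction d with
  | zero => simp
  | succ d IH =>
    have hI : Finset.Icc (-((d + 1 : ℕ) : ℤ)) ((d + 1 : ℕ) : ℤ) =
        insert (-((d : ℤ) + 1)) (insert ((d : ℤ) + 1) (Finset.Icc (-(d : ℤ)) d)) := by
      ext k
      simp only [Finset.mem_Icc, Finset.mem_insert, Nat.cast_add, Nat.cast_one]
      omega
    have h1 : (d : ℤ) + 1 ∉ Finset.Icc (-(d : ℤ)) d := by simp
    have h2 : -((d : ℤ) + 1) ∉ insert ((d : ℤ) + 1) (Finset.Icc (-(d : ℤ)) d) := by
      simp only [Finset.mem_insert, Finset.mem_Icc]; omega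
    rw [hI, Finset.sum_insert h2, Finset.sum_insert h1, IH, Finset.sum_range_succ]
    ring

/-- **Sums over the nonzero representatives of a function of `℘`**:
`Σ_{0 < |k| ≤ d} f(℘(kw)) = 2 Σ_{k=1}^{d} f(℘(kw))` (`℘` is even; the right side is indexed by
`i = k − 1 ∈ range d`). [folklore] -/
lemma sum_repsOdd_erase_zero (hw : w ≠ 0) (f : ℂ → ℂ) :
    ∑ c ∈ (repsOdd w d).erase 0, f (℘[L] c) =
      2 * ∑ i ∈ Finset.range d, f (℘[L] ((i + 1 : ℕ) * w)) := by
  have hinj : Set.InjOn (fun k : ℤ ↦ (k : ℂ) * w) (Finset.Icc (-(d : ℤ)) d : Set ℤ) := by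
    intro k _ k' _ h
    exact_mod_cast mul_right_cancel₀ hw h
  have h0 : (0 : ℂ) ∈ repsOdd w d := zero_mem_repsOdd w d
  rw [Finset.sum_erase_eq_sub h0, repsOdd, Finset.sum_image hinj,
    sum_Icc_neg_self (fun k ↦ f (℘[L] ((k : ℂ) * w))) d, Finset.mul_sum]
  simp only [Int.cast_zero, zero_mul, Int.cast_add, Int.cast_neg, Int.cast_one,
    Int.cast_natCast, Nat.cast_add, Nat.cast_one, neg_mul, L.weierstrassP_neg]
  rw [add_sub_cancel_left]
  refine Finset.sum_congr rfl fun i _ ↦ ?_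
  ring


/-! ### The Laurent-matching equations for complex multiplication of odd norm -/

end RepsOdd

section CMOdd

variable {L : PeriodPair} {α w K : ℂ} {d : ℕ}

/-- **The transformation formula for complex multiplication of odd norm**: if
`α⁻¹Λ = ⋃_{|k| ≤ d} (kw + Λ)` (i.e. `αx ∈ Λ ↔ ∃ k, |k| ≤ d ∧ x − kw ∈ Λ`) and `kw ∉ Λ` for
`0 < |k| ≤ 2d`, then off `α⁻¹Λ`,
`℘_{α⁻¹Λ}(z) = Σ_{|k| ≤ d} ℘_Λ(z − kw) − Σ_{0 < |k| ≤ d} ℘_Λ(kw)`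
(`PeriodPair.weierstrassP_transformation` for the representatives `repsOdd w d`). [folklore] -/
theorem cmOdd_transformation (hα : α ≠ 0)
    (hΛ : ∀ x, α * x ∈ L.lattice ↔ ∃ k : ℤ, -(d : ℤ) ≤ k ∧ k ≤ d ∧ x - k * w ∈ L.lattice)
    (hsmall : ∀ k : ℤ, k ≠ 0 → -(2 * d : ℤ) ≤ k → k ≤ 2 * d → (k : ℂ) * w ∉ L.lattice) {z : ℂ}
    (hz : z ∉ (L.mulLeft α⁻¹ (inv_ne_zero hα)).lattice) :
    ℘[L.mulLeft α⁻¹ (inv_ne_zero hα)] z =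
      ∑ c ∈ repsOdd w d, ℘[L] (z - c) - ∑ c ∈ (repsOdd w d).erase 0, ℘[L] c := by
  have hΛ' : ∀ x, x ∈ (L.mulLeft α⁻¹ (inv_ne_zero hα)).lattice ↔
      ∃ c ∈ repsOdd w d, x - c ∈ L.lattice := fun x ↦ by
    rw [mem_mulLeft_inv_lattice hα, hΛ, exists_mem_repsOdd_iff]
  exact weierstrassP_transformation hΛ' (zero_mem_repsOdd w d) (repsOdd_incongruent hsmall) hz

/-- **The Laurent-matching equations.**  Let `αΛ ⊂ Λ` with `α⁻¹Λ = ⋃_{|k| ≤ d} (kw + Λ)` written as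
the transformation formula `℘_{α⁻¹Λ}(z) = Σ_{|k| ≤ d} ℘_Λ(z − kw) − K` off `α⁻¹Λ`
(`PeriodPair.weierstrassP_transformation`), the `kw`, `0 < |k| ≤ 2d`, off `Λ`.  Then for every
`n ≥ 1`: `(n+1)!·(αⁿ⁺² − 1)·G_{n+2}(Λ) = Σ_{0 < |k| ≤ d} ℘_Λ⁽ⁿ⁾(−kw)` — the `zⁿ`-Taylor coefficient at
`0` of `℘_{α⁻¹Λ} − ℘_Λ`, using `G_{n+2}(α⁻¹Λ) = αⁿ⁺²G_{n+2}(Λ)` (the method of Cox §10.C (10.21)–(10.22)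
in arbitrary odd norm). [folklore] -/
theorem cmOdd_taylor (hα : α ≠ 0)
    (hsmall : ∀ k : ℤ, k ≠ 0 → -(2 * d : ℤ) ≤ k → k ≤ 2 * d → (k : ℂ) * w ∉ L.lattice)
    (hT : ∀ z, z ∉ (L.mulLeft α⁻¹ (inv_ne_zero hα)).lattice →
      ℘[L.mulLeft α⁻¹ (inv_ne_zero hα)] z = ∑ c ∈ repsOdd w d, ℘[L] (z - c) - K)
    {n : ℕ} (hn : n ≠ 0) :
    (n + 1).factorial * (α ^ (n + 2) - 1) * L.G (n + 2) =
      ∑ c ∈ (repsOdd w d).erase 0, iteratedDeriv n ℘[L] (-c) := by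
  have h := iteratedDeriv_weierstrassPExcept_sub_of_transformation (zero_mem_repsOdd w d)
    (fun c hc ↦ notMem_of_mem_repsOdd_erase hsmall hc) hT hn
  rw [(L.mulLeft α⁻¹ (inv_ne_zero hα)).iteratedDeriv_weierstrassPExcept_self,
    L.iteratedDeriv_weierstrassPExcept_self, if_neg hn, if_neg hn, sumInvPow_zero, sumInvPow_zero,
    G_mulLeft, inv_pow, inv_inv] at h
  linear_combination h

/-- **The even Laurent-matching equations in closed form**: if moreover `℘⁽ⁿ⁾ = P(℘)` off `Λ`
(`n` even, `PeriodPair.iteratedDeriv_two_mul_…`), then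
`(n+1)!·(αⁿ⁺² − 1)·G_{n+2} = 2 Σ_{k=1}^{d} P(℘(kw))`. [folklore] -/
theorem cmOdd_taylor_even (hα : α ≠ 0) (hd : 1 ≤ d)
    (hsmall : ∀ k : ℤ, k ≠ 0 → -(2 * d : ℤ) ≤ k → k ≤ 2 * d → (k : ℂ) * w ∉ L.lattice)
    (hT : ∀ z, z ∉ (L.mulLeft α⁻¹ (inv_ne_zero hα)).lattice →
      ℘[L.mulLeft α⁻¹ (inv_ne_zero hα)] z = ∑ c ∈ repsOdd w d, ℘[L] (z - c) - K)
    {n : ℕ} (hn : n ≠ 0) {P : ℂ → ℂ} (hP : ∀ z, z ∉ L.lattice → iteratedDeriv n ℘[L] z = P (℘[L] z)) :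
    (n + 1).factorial * (α ^ (n + 2) - 1) * L.G (n + 2) =
      2 * ∑ i ∈ Finset.range d, P (℘[L] ((i + 1 : ℕ) * w)) := by
  rw [cmOdd_taylor hα hsmall hT hn, ← sum_repsOdd_erase_zero (w_ne_zero_of_smul_notMem hsmall hd)]
  refine Finset.sum_congr rfl fun c hc ↦ ?_
  have hc' : -c ∉ L.lattice := fun h ↦
    notMem_of_mem_repsOdd_erase hsmall hc (by simpa using neg_mem h)
  rw [hP (-c) hc', L.weierstrassP_neg]

end CMOdd

section EvenDerivatives

variable (L : PeriodPair)

/-! ### Polynomial functions given by coefficient tables -/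

/-- The polynomial function `Σ_{i ≤ d} c_i xⁱ`. [folklore] -/
def polyFun (c : ℕ → ℂ) (d : ℕ) (x : ℂ) : ℂ := ∑ i ∈ Finset.range (d + 1), c i * x ^ i

/-- Derivative of a polynomial function. [folklore] -/
lemma hasDerivAt_polyFun (c : ℕ → ℂ) (d : ℕ) (x : ℂ) :
    HasDerivAt (polyFun c d) (∑ i ∈ Finset.range (d + 1), c i * (i * x ^ (i - 1))) x := by
  unfold polyFun
  exact HasDerivAt.fun_sum fun i _ ↦ (hasDerivAt_pow i x).const_mul (c i)

/-- The derivative of `Σ_{i ≤ d+1} c_i xⁱ` is `Σ_{j ≤ d} (j+1)c_{j+1} xʲ`. [folklore] -/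
lemma deriv_polyFun (c : ℕ → ℂ) (d : ℕ) (x : ℂ) :
    deriv (polyFun c (d + 1)) x = polyFun (fun j ↦ (j + 1) * c (j + 1)) d x := by
  rw [(hasDerivAt_polyFun c (d + 1) x).deriv, polyFun, Finset.sum_range_succ']
  simp only [Nat.cast_zero, zero_mul, mul_zero, add_zero, Nat.cast_add, Nat.cast_one,
    Nat.add_sub_cancel]
  refine Finset.sum_congr rfl fun i _ ↦ ?_
  ring

/-- `HasDerivAt` form of `deriv_polyFun`. [folklore] -/
lemma hasDerivAt_polyFun' (c : ℕ → ℂ) (d : ℕ) (x : ℂ) :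
    HasDerivAt (polyFun c (d + 1)) (polyFun (fun j ↦ (j + 1) * c (j + 1)) d x) x := by
  rw [← deriv_polyFun]
  exact (hasDerivAt_polyFun c (d + 1) x).differentiableAt.hasDerivAt

/-! ### Differentiating `A(℘)` and `B(℘)·℘'` -/

/-- Step from an even derivative: if `℘⁽ᵏ⁾ = P(℘)` off `Λ` then `℘⁽ᵏ⁺¹⁾ = P'(℘)·℘'`. [folklore] -/
lemma iteratedDeriv_succ_of_eq_comp {P P' : ℂ → ℂ} (hP : ∀ x, HasDerivAt P (P' x) x) {k : ℕ}
    (h : ∀ z, z ∉ L.lattice → iteratedDeriv k ℘[L] z = P (℘[L] z)) {z : ℂ} (hz : z ∉ L.lattice) :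
    iteratedDeriv (k + 1) ℘[L] z = P' (℘[L] z) * ℘'[L] z := by
  have hev : iteratedDeriv k ℘[L] =ᶠ[𝓝 z] fun w ↦ P (℘[L] w) := by
    filter_upwards [L.isClosed_lattice.isOpen_compl.mem_nhds hz] with w hw
    exact h w hw
  rw [iteratedDeriv_succ, hev.deriv_eq]
  exact ((hP (℘[L] z)).comp z (L.hasDerivAt_weierstrassP hz)).deriv

/-- Step from an odd derivative: if `℘⁽ᵏ⁾ = Q(℘)·℘'` off `Λ` then
`℘⁽ᵏ⁺¹⁾ = Q'(℘)(4℘³ − g₂℘ − g₃) + Q(℘)(6℘² − g₂/2)` (`℘'² = 4℘³ − g₂℘ − g₃`, `℘'' = 6℘² − g₂/2`).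
[folklore] -/
lemma iteratedDeriv_succ_of_eq_comp_mul {Q Q' : ℂ → ℂ} (hQ : ∀ x, HasDerivAt Q (Q' x) x) {k : ℕ}
    (h : ∀ z, z ∉ L.lattice → iteratedDeriv k ℘[L] z = Q (℘[L] z) * ℘'[L] z) {z : ℂ}
    (hz : z ∉ L.lattice) :
    iteratedDeriv (k + 1) ℘[L] z = Q' (℘[L] z) * (4 * ℘[L] z ^ 3 - L.g₂ * ℘[L] z - L.g₃) +
      Q (℘[L] z) * (6 * ℘[L] z ^ 2 - L.g₂ / 2) := by
  have hev : iteratedDeriv k ℘[L] =ᶠ[𝓝 z] fun w ↦ Q (℘[L] w) * ℘'[L] w := by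
    filter_upwards [L.isClosed_lattice.isOpen_compl.mem_nhds hz] with w hw
    exact h w hw
  rw [iteratedDeriv_succ, hev.deriv_eq]
  have h1 := (hQ (℘[L] z)).comp z (L.hasDerivAt_weierstrassP hz)
  have h2 := L.hasDerivAt_derivWeierstrassP hz
  have h12 : HasDerivAt (fun w ↦ Q (℘[L] w) * ℘'[L] w)
      (Q' (℘[L] z) * ℘'[L] z * ℘'[L] z + Q (℘[L] z) * (6 * ℘[L] z ^ 2 - L.g₂ / 2)) z :=
    h1.mul h2
  rw [h12.deriv]
  linear_combination Q' (℘[L] z) * L.derivWeierstrassP_sq z hz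

/-! ### The polynomials `P_m` with `℘⁽²ᵐ⁾ = P_m(℘)` (`m ≤ 8`) -/

/-- Coefficients of `P_0` (`℘⁽0⁾ = P_0(℘)`; degree `1`). [folklore] -/
def pc0 : ℕ → ℂ := fun i ↦
  match i with
    | 0 => 0
    | 1 => 1
    | _ => 0

/-- `P_0 = X`. [folklore] -/
def P0 : ℂ → ℂ := polyFun pc0 1

/-- Coefficients of `P_1` (`℘⁽2⁾ = P_1(℘)`; degree `2`). [folklore] -/
def pc1 (L : PeriodPair) : ℕ → ℂ := fun i ↦
  match i with
    | 0 => -1/2*L.g₂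
    | 1 => 0
    | 2 => 6
    | _ => 0

/-- `P_1`. [folklore] -/
def P1 (L : PeriodPair) : ℂ → ℂ := polyFun L.pc1 2

/-- Coefficients of `P_2` (`℘⁽4⁾ = P_2(℘)`; degree `3`). [folklore] -/
def pc2 (L : PeriodPair) : ℕ → ℂ := fun i ↦
  match i with
    | 0 => -12*L.g₃
    | 1 => -18*L.g₂
    | 2 => 0
    | 3 => 120
    | _ => 0

/-- `P_2`. [folklore] -/
def P2 (L : PeriodPair) : ℂ → ℂ := polyFun L.pc2 3

/-- Coefficients of `P_3` (`℘⁽6⁾ = P_3(℘)`; degree `4`). [folklore] -/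
def pc3 (L : PeriodPair) : ℕ → ℂ := fun i ↦
  match i with
    | 0 => 9*L.g₂^2
    | 1 => -720*L.g₃
    | 2 => -1008*L.g₂
    | 3 => 0
    | 4 => 5040
    | _ => 0

/-- `P_3`. [folklore] -/
def P3 (L : PeriodPair) : ℂ → ℂ := polyFun L.pc3 4

/-- Coefficients of `P_4` (`℘⁽8⁾ = P_4(℘)`; degree `5`). [folklore] -/
def pc4 (L : PeriodPair) : ℕ → ℂ := fun i ↦
  match i with
    | 0 => 2376*L.g₃*L.g₂
    | 1 => 3024*L.g₂^2
    | 2 => -64800*L.g₃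
    | 3 => -90720*L.g₂
    | 4 => 0
    | 5 => 362880
    | _ => 0

/-- `P_4`. [folklore] -/
def P4 (L : PeriodPair) : ℂ → ℂ := polyFun L.pc4 5

/-- Coefficients of `P_5` (`℘⁽10⁾ = P_5(℘)`; degree `6`). [folklore] -/
def pc5 (L : PeriodPair) : ℕ → ℂ := fun i ↦
  match i with
    | 0 => -1512*L.g₂^3 + 129600*L.g₃^2
    | 1 => 738720*L.g₃*L.g₂
    | 2 => 698544*L.g₂^2
    | 3 => -8553600*L.g₃
    | 4 => -11975040*L.g₂
    | 5 => 0
    | 6 => 39916800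
    | _ => 0

/-- `P_5`. [folklore] -/
def P5 (L : PeriodPair) : ℂ → ℂ := polyFun L.pc5 6

/-- Coefficients of `P_6` (`℘⁽12⁾ = P_6(℘)`; degree `7`). [folklore] -/
def pc6 (L : PeriodPair) : ℕ → ℂ := fun i ↦
  match i with
    | 0 => -1766448*L.g₃*L.g₂^2
    | 1 => -2095632*L.g₂^3 + 51321600*L.g₃^2
    | 2 => 212284800*L.g₃*L.g₂
    | 3 => 181621440*L.g₂^2
    | 4 => -1556755200*L.g₃
    | 5 => -2179457280*L.g₂
    | 6 => 0
    | 7 => 6227020800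
    | _ => 0

/-- `P_6`. [folklore] -/
def P6 (L : PeriodPair) : ℂ → ℂ := polyFun L.pc6 7

/-- Coefficients of `P_7` (`℘⁽14⁾ = P_7(℘)`; degree `8`). [folklore] -/
def pc7 (L : PeriodPair) : ℕ → ℂ := fun i ↦
  match i with
    | 0 => 1047816*L.g₂^4 - 450230400*L.g₃^2*L.g₂
    | 1 => -1726583040*L.g₃*L.g₂^2
    | 2 => -1374734592*L.g₂^3 + 18988992000*L.g₃^2
    | 3 => 69629414400*L.g₃*L.g₂
    | 4 => 56665889280*L.g₂^2
    | 5 => -373621248000*L.g₃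
    | 6 => -523069747200*L.g₂
    | 7 => 0
    | 8 => 1307674368000
    | _ => 0

/-- `P_7`. [folklore] -/
def P7 (L : PeriodPair) : ℂ → ℂ := polyFun L.pc7 8

/-- Coefficients of `P_8` (`℘⁽16⁾ = P_8(℘)`; degree `9`). [folklore] -/
def pc8 (L : PeriodPair) : ℕ → ℂ := fun i ↦
  match i with
    | 0 => 3612760704*L.g₃*L.g₂^3 - 37977984000*L.g₃^3
    | 1 => 4124203776*L.g₂^4 - 474743462400*L.g₃^2*L.g₂
    | 2 => -1212570777600*L.g₃*L.g₂^2
    | 3 => -820817141760*L.g₂^3 + 7852204800000*L.g₃^2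
    | 4 => 27023005900800*L.g₃*L.g₂
    | 5 => 21341245685760*L.g₂^2
    | 6 => -114328101888000*L.g₃
    | 7 => -160059342643200*L.g₂
    | 8 => 0
    | 9 => 355687428096000
    | _ => 0

/-- `P_8`. [folklore] -/
def P8 (L : PeriodPair) : ℂ → ℂ := polyFun L.pc8 9


/-! ### The chain `℘⁽²ᵐ⁾ = P_m(℘)`, `℘⁽²ᵐ⁺¹⁾ = P_m'(℘)℘'` -/

/-- `℘⁽⁰⁾ = P₀(℘) = ℘`. [folklore] -/
theorem iteratedDeriv_zero_weierstrassP_eq {z : ℂ} (_hz : z ∉ L.lattice) :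
    iteratedDeriv 0 ℘[L] z = P0 (℘[L] z) := by
  simp [P0, polyFun, pc0, Finset.sum_range_succ]

/-- `℘⁽1⁾ = P_0'(℘)·℘'`. [folklore] -/
theorem iteratedDeriv_1_weierstrassP_eq {z : ℂ} (hz : z ∉ L.lattice) :
    iteratedDeriv 1 ℘[L] z = polyFun (fun j : ℕ ↦ ((j:ℂ) + 1) * pc0 (j + 1)) 0 (℘[L] z) * ℘'[L] z :=
  L.iteratedDeriv_succ_of_eq_comp (fun x ↦ hasDerivAt_polyFun' pc0 0 x)
    (fun _ hw ↦ L.iteratedDeriv_zero_weierstrassP_eq hw) hz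

/-- `℘⁽2⁾ = P_1(℘)`. [folklore] -/
theorem iteratedDeriv_2_weierstrassP_eq {z : ℂ} (hz : z ∉ L.lattice) :
    iteratedDeriv 2 ℘[L] z = L.P1 (℘[L] z) := by
  have h := L.iteratedDeriv_succ_of_eq_comp_mul (Q' := (fun _ : ℂ ↦ (0:ℂ))) (fun x ↦ (hasDerivAt_polyFun (fun j : ℕ ↦ ((j:ℂ) + 1) * pc0 (j + 1)) 0 x).congr_deriv (by simp))
    (fun _ hw ↦ L.iteratedDeriv_1_weierstrassP_eq hw) hz
  rw [h]
  simp only [P1, polyFun, Finset.sum_range_succ, Finset.sum_range_zero, pc0, pc1]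
  push_cast
  ring

/-- `℘⁽3⁾ = P_1'(℘)·℘'`. [folklore] -/
theorem iteratedDeriv_3_weierstrassP_eq {z : ℂ} (hz : z ∉ L.lattice) :
    iteratedDeriv 3 ℘[L] z = polyFun (fun j : ℕ ↦ ((j:ℂ) + 1) * L.pc1 (j + 1)) 1 (℘[L] z) * ℘'[L] z :=
  L.iteratedDeriv_succ_of_eq_comp (fun x ↦ hasDerivAt_polyFun' L.pc1 1 x)
    (fun _ hw ↦ L.iteratedDeriv_2_weierstrassP_eq hw) hz

/-- `℘⁽4⁾ = P_2(℘)`. [folklore] -/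
theorem iteratedDeriv_4_weierstrassP_eq {z : ℂ} (hz : z ∉ L.lattice) :
    iteratedDeriv 4 ℘[L] z = L.P2 (℘[L] z) := by
  have h := L.iteratedDeriv_succ_of_eq_comp_mul  (fun x ↦ hasDerivAt_polyFun' (fun j : ℕ ↦ ((j:ℂ) + 1) * L.pc1 (j + 1)) 0 x)
    (fun _ hw ↦ L.iteratedDeriv_3_weierstrassP_eq hw) hz
  rw [h]
  simp only [P2, polyFun, Finset.sum_range_succ, Finset.sum_range_zero, pc1, pc2]
  push_cast
  ring

/-- `℘⁽5⁾ = P_2'(℘)·℘'`. [folklore] -/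
theorem iteratedDeriv_5_weierstrassP_eq {z : ℂ} (hz : z ∉ L.lattice) :
    iteratedDeriv 5 ℘[L] z = polyFun (fun j : ℕ ↦ ((j:ℂ) + 1) * L.pc2 (j + 1)) 2 (℘[L] z) * ℘'[L] z :=
  L.iteratedDeriv_succ_of_eq_comp (fun x ↦ hasDerivAt_polyFun' L.pc2 2 x)
    (fun _ hw ↦ L.iteratedDeriv_4_weierstrassP_eq hw) hz

/-- `℘⁽6⁾ = P_3(℘)`. [folklore] -/
theorem iteratedDeriv_6_weierstrassP_eq {z : ℂ} (hz : z ∉ L.lattice) :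
    iteratedDeriv 6 ℘[L] z = L.P3 (℘[L] z) := by
  have h := L.iteratedDeriv_succ_of_eq_comp_mul  (fun x ↦ hasDerivAt_polyFun' (fun j : ℕ ↦ ((j:ℂ) + 1) * L.pc2 (j + 1)) 1 x)
    (fun _ hw ↦ L.iteratedDeriv_5_weierstrassP_eq hw) hz
  rw [h]
  simp only [P3, polyFun, Finset.sum_range_succ, Finset.sum_range_zero, pc2, pc3]
  push_cast
  ring

/-- `℘⁽7⁾ = P_3'(℘)·℘'`. [folklore] -/
theorem iteratedDeriv_7_weierstrassP_eq {z : ℂ} (hz : z ∉ L.lattice) :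
    iteratedDeriv 7 ℘[L] z = polyFun (fun j : ℕ ↦ ((j:ℂ) + 1) * L.pc3 (j + 1)) 3 (℘[L] z) * ℘'[L] z :=
  L.iteratedDeriv_succ_of_eq_comp (fun x ↦ hasDerivAt_polyFun' L.pc3 3 x)
    (fun _ hw ↦ L.iteratedDeriv_6_weierstrassP_eq hw) hz

/-- `℘⁽8⁾ = P_4(℘)`. [folklore] -/
theorem iteratedDeriv_8_weierstrassP_eq {z : ℂ} (hz : z ∉ L.lattice) :
    iteratedDeriv 8 ℘[L] z = L.P4 (℘[L] z) := by
  have h := L.iteratedDeriv_succ_of_eq_comp_mul  (fun x ↦ hasDerivAt_polyFun' (fun j : ℕ ↦ ((j:ℂ) + 1) * L.pc3 (j + 1)) 2 x)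
    (fun _ hw ↦ L.iteratedDeriv_7_weierstrassP_eq hw) hz
  rw [h]
  simp only [P4, polyFun, Finset.sum_range_succ, Finset.sum_range_zero, pc3, pc4]
  push_cast
  ring

/-- `℘⁽9⁾ = P_4'(℘)·℘'`. [folklore] -/
theorem iteratedDeriv_9_weierstrassP_eq {z : ℂ} (hz : z ∉ L.lattice) :
    iteratedDeriv 9 ℘[L] z = polyFun (fun j : ℕ ↦ ((j:ℂ) + 1) * L.pc4 (j + 1)) 4 (℘[L] z) * ℘'[L] z :=
  L.iteratedDeriv_succ_of_eq_comp (fun x ↦ hasDerivAt_polyFun' L.pc4 4 x)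
    (fun _ hw ↦ L.iteratedDeriv_8_weierstrassP_eq hw) hz

/-- `℘⁽10⁾ = P_5(℘)`. [folklore] -/
theorem iteratedDeriv_10_weierstrassP_eq {z : ℂ} (hz : z ∉ L.lattice) :
    iteratedDeriv 10 ℘[L] z = L.P5 (℘[L] z) := by
  have h := L.iteratedDeriv_succ_of_eq_comp_mul  (fun x ↦ hasDerivAt_polyFun' (fun j : ℕ ↦ ((j:ℂ) + 1) * L.pc4 (j + 1)) 3 x)
    (fun _ hw ↦ L.iteratedDeriv_9_weierstrassP_eq hw) hz
  rw [h]
  simp only [P5, polyFun, Finset.sum_range_succ, Finset.sum_range_zero, pc4, pc5]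
  push_cast
  ring

/-- `℘⁽11⁾ = P_5'(℘)·℘'`. [folklore] -/
theorem iteratedDeriv_11_weierstrassP_eq {z : ℂ} (hz : z ∉ L.lattice) :
    iteratedDeriv 11 ℘[L] z = polyFun (fun j : ℕ ↦ ((j:ℂ) + 1) * L.pc5 (j + 1)) 5 (℘[L] z) * ℘'[L] z :=
  L.iteratedDeriv_succ_of_eq_comp (fun x ↦ hasDerivAt_polyFun' L.pc5 5 x)
    (fun _ hw ↦ L.iteratedDeriv_10_weierstrassP_eq hw) hz

/-- `℘⁽12⁾ = P_6(℘)`. [folklore] -/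
theorem iteratedDeriv_12_weierstrassP_eq {z : ℂ} (hz : z ∉ L.lattice) :
    iteratedDeriv 12 ℘[L] z = L.P6 (℘[L] z) := by
  have h := L.iteratedDeriv_succ_of_eq_comp_mul  (fun x ↦ hasDerivAt_polyFun' (fun j : ℕ ↦ ((j:ℂ) + 1) * L.pc5 (j + 1)) 4 x)
    (fun _ hw ↦ L.iteratedDeriv_11_weierstrassP_eq hw) hz
  rw [h]
  simp only [P6, polyFun, Finset.sum_range_succ, Finset.sum_range_zero, pc5, pc6]
  push_cast
  ring

/-- `℘⁽13⁾ = P_6'(℘)·℘'`. [folklore] -/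
theorem iteratedDeriv_13_weierstrassP_eq {z : ℂ} (hz : z ∉ L.lattice) :
    iteratedDeriv 13 ℘[L] z = polyFun (fun j : ℕ ↦ ((j:ℂ) + 1) * L.pc6 (j + 1)) 6 (℘[L] z) * ℘'[L] z :=
  L.iteratedDeriv_succ_of_eq_comp (fun x ↦ hasDerivAt_polyFun' L.pc6 6 x)
    (fun _ hw ↦ L.iteratedDeriv_12_weierstrassP_eq hw) hz

/-- `℘⁽14⁾ = P_7(℘)`. [folklore] -/
theorem iteratedDeriv_14_weierstrassP_eq {z : ℂ} (hz : z ∉ L.lattice) :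
    iteratedDeriv 14 ℘[L] z = L.P7 (℘[L] z) := by
  have h := L.iteratedDeriv_succ_of_eq_comp_mul  (fun x ↦ hasDerivAt_polyFun' (fun j : ℕ ↦ ((j:ℂ) + 1) * L.pc6 (j + 1)) 5 x)
    (fun _ hw ↦ L.iteratedDeriv_13_weierstrassP_eq hw) hz
  rw [h]
  simp only [P7, polyFun, Finset.sum_range_succ, Finset.sum_range_zero, pc6, pc7]
  push_cast
  ring

/-- `℘⁽15⁾ = P_7'(℘)·℘'`. [folklore] -/
theorem iteratedDeriv_15_weierstrassP_eq {z : ℂ} (hz : z ∉ L.lattice) :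
    iteratedDeriv 15 ℘[L] z = polyFun (fun j : ℕ ↦ ((j:ℂ) + 1) * L.pc7 (j + 1)) 7 (℘[L] z) * ℘'[L] z :=
  L.iteratedDeriv_succ_of_eq_comp (fun x ↦ hasDerivAt_polyFun' L.pc7 7 x)
    (fun _ hw ↦ L.iteratedDeriv_14_weierstrassP_eq hw) hz

/-- `℘⁽16⁾ = P_8(℘)`. [folklore] -/
theorem iteratedDeriv_16_weierstrassP_eq {z : ℂ} (hz : z ∉ L.lattice) :
    iteratedDeriv 16 ℘[L] z = L.P8 (℘[L] z) := by
  have h := L.iteratedDeriv_succ_of_eq_comp_mul  (fun x ↦ hasDerivAt_polyFun' (fun j : ℕ ↦ ((j:ℂ) + 1) * L.pc7 (j + 1)) 6 x)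
    (fun _ hw ↦ L.iteratedDeriv_15_weierstrassP_eq hw) hz
  rw [h]
  simp only [P8, polyFun, Finset.sum_range_succ, Finset.sum_range_zero, pc7, pc8]
  push_cast
  ring

end EvenDerivatives

end PeriodPair

end
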